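import Literature.Topology.FourManifolds.ConcordanceStripReplacement
import Literature.Topology.FourManifolds.LocalLinearisationIsotopy
import Literature.Topology.FourManifolds.SphereChartOrientation
import Literature.Topology.FourManifolds.KnotFlatArc
import HarnessLib

/-!
# The end charts of a good tube and small copies of a knot inside them

Topic `Literature/Topology/FourManifolds`; a brick of the decomposition of the Fox–Milnor
congruence `Literature.Topology.FourManifolds.Knot.IsConnectedSum.isConcordant` (the remaining
named fact `Knot.exists_isConnectedSum_isConcordant_left`, `BandSumConcordanceCore.lean`). A good
tube of a conical concordance (`ConcordanceStripTubeGeometry.lean`) is read at its two ends as two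
charts `ℝ³ ⊇ region → 𝕊³`, and a knot shrunk affinely into the chart region and re-embedded by
either chart is shown ambient isotopic to the original knot. Everything here is proved.

* `mpt t x = ((x 0, t), (x 1, x 2))`, `jmap`, `ρ` — model coordinates `ℝ³ = ℝ_θ × ℝ²_d` of the
  tube at level `t`, and the reordering `ℝ³ × ℝ ≅ (ℝ × ℝ) × (ℝ × ℝ)` inserting the time.
* `c₁ x = tube (mpt 1 x)`, `c₂ x = ½ • tube (mpt 2 x)` — **the end charts** (unit norm, `C^∞`);
  near the ends the tube is the cone over them (`tube_mpt_of_le/ge`), so the time derivative of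
  the tube at the ends is the chart (`fderiv_tube_eT_one/two`) and the frame of the chart
  extended by its value is the reordered tube derivative (`frame_c₁`, `frame_c₂`).
* `region θ₀ η ε` (open); on it the end charts are injective immersions (`injOn_c₁/₂`,
  `injective_fderiv_c₁/₂`, from `GoodTube.injOn/injective_fderiv`), and **their orientation
  determinants have the same sign** (`frameDet_c₁_pos_iff`: the tube frame at level `t` is a frame for
  `t ∈ [1, 2]` and depends continuously on `t`).
* `g₁ = ψ ∘ c₁`, `g₂ = ψ ∘ c₂` on `W₁`, `W₂` (where the chart misses the south pole): `C^∞`,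
  `φ ∘ gᵢ = cᵢ` (`KnotsInBall.phi`), injective derivative on the region, and **Jacobians of the
  same sign** (`det_fderiv_g₁_mul_pos`, via `SphereChartOrientation.lean`); `det_toMat` and the
  transfer `det_toMat_comp_pos` of the hypothesis `det (Dg₁ M) > 0` to `g₂`.
* `affT x₀ c M l z = x₀ + l • M (z - c)`; `tinyCurve₁/₂`, `tinyKnot₁/₂` — the composite
  `cᵢ ∘ T ∘ ψ ∘ Kn` as a regular simple closed curve and as a knot
  (`IsRegularClosedCurve.toKnot`), with values `coe_tinyKnot₁/₂`.
* **`exists_isIsotopic_tinyKnot`** — for all small `l > 0`, `T` maps `ψ ∘ Kn` into the region and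
  both `tinyKnot₁` and `tinyKnot₂` are ambient isotopic to `Kn`
  (`exists_ambientIsotopy_comp_affine` + `AmbientIsotopy.alongChart`).

## References

* M. W. Hirsch, *Differential Topology*, GTM 33 (1976), Ch. 8 §1 Thm. 1.4, §3 Thm. 3.1 (disc
  embeddings of the same orientation are isotopic through their linearisations); Ch. 4 §5
  (tubes). [HirschDT1976]
* R. H. Fox, J. W. Milnor, Osaka J. Math. 3 (1966), §1 (the consumer). [FoxMilnor1966]

## Design notes

`tinyKnot₁/₂` take the good tube, `Kn` off the south pole, `l ≠ 0` and the region condition as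
proof arguments (they enter the regularity and injectivity of the curve). No named facts, no
`sorry`; `𝔼 n`, `𝕊 n` are local notation as in `Knots.lean`.
-/

open scoped Manifold ContDiff Topology RealInnerProductSpace
open Function Set Metric

noncomputable section

namespace Literature.Topology.FourManifolds

/-- Local notation: `𝔼 n` is the model Euclidean space `EuclideanSpace ℝ (Fin n)`. -/
local notation "𝔼 " n:arg => EuclideanSpace ℝ (Fin n)

/-- Local notation: `𝕊 n` is the unit sphere in `EuclideanSpace ℝ (Fin (n + 1))`. -/
local notation "𝕊 " n:arg => (Metric.sphere (0 : EuclideanSpace ℝ (Fin (n + 1))) 1)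

attribute [local instance] fact_finrank_euclideanSpace_succ

namespace Knot.IsConicalConcordance

open StripFrame CircleFraming KnotsInBall AffineIsotopy

variable {K K' : Knot} {f : (𝕊 1) × ℝ → 𝔼 4} {δ : ℝ} (h : IsConicalConcordance K K' f δ) (w : 𝔼 4)

/-! ### Model coordinates `ℝ³ = ℝ_θ × ℝ²_d` and the two end charts -/

/-- The model point over `(θ, t) = (x 0, t)` with normal coordinates `(x 1, x 2)`. [folklore] -/
def mpt (t : ℝ) (x : 𝔼 3) : (ℝ × ℝ) × (ℝ × ℝ) := ((x 0, t), (x 1, x 2))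

/-- The linear part of `mpt t`: `v ↦ ((v 0, 0), (v 1, v 2))`. [folklore] -/
def jmap : (𝔼 3) →L[ℝ] (ℝ × ℝ) × (ℝ × ℝ) :=
  ((EuclideanSpace.proj (0 : Fin 3)).prod (0 : (𝔼 3) →L[ℝ] ℝ)).prod
    ((EuclideanSpace.proj (1 : Fin 3)).prod (EuclideanSpace.proj (2 : Fin 3)))

/-- Evaluation of `jmap`. [folklore] -/
@[simp]
theorem jmap_apply (v : 𝔼 3) : jmap v = ((v 0, 0), (v 1, v 2)) := by
  simp [jmap]

/-- `jmap` is injective. [folklore] -/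
theorem injective_jmap : Injective jmap := by
  intro v v' hv
  simp only [jmap_apply, Prod.mk.injEq] at hv
  ext i
  fin_cases i
  · exact hv.1.1
  · exact hv.2.1
  · exact hv.2.2

/-- `mpt t` is `C^∞`. [folklore] -/
theorem contDiff_mpt (t : ℝ) : ContDiff ℝ ∞ (mpt t) :=
  (((EuclideanSpace.proj (0 : Fin 3) : (𝔼 3) →L[ℝ] ℝ).contDiff.prodMk contDiff_const).prodMk
    (((EuclideanSpace.proj (1 : Fin 3) : (𝔼 3) →L[ℝ] ℝ).contDiff).prodMk
      ((EuclideanSpace.proj (2 : Fin 3) : (𝔼 3) →L[ℝ] ℝ).contDiff)))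

/-- `mpt t` is affine with linear part `jmap`. [folklore] -/
theorem hasFDerivAt_mpt (t : ℝ) (x : 𝔼 3) : HasFDerivAt (mpt t) jmap x := by
  have h0 := (EuclideanSpace.proj (0 : Fin 3) : (𝔼 3) →L[ℝ] ℝ).hasFDerivAt (x := x)
  have h1 := (EuclideanSpace.proj (1 : Fin 3) : (𝔼 3) →L[ℝ] ℝ).hasFDerivAt (x := x)
  have h2 := (EuclideanSpace.proj (2 : Fin 3) : (𝔼 3) →L[ℝ] ℝ).hasFDerivAt (x := x)
  have ht : HasFDerivAt (fun _ : 𝔼 3 ↦ t) (0 : (𝔼 3) →L[ℝ] ℝ) x := hasFDerivAt_const t x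
  have := (h0.prodMk ht).prodMk (h1.prodMk h2)
  refine this.congr_fderiv ?_
  ext v <;> simp [jmap]

/-- The **reordering isomorphism** `ℝ × ℝ³ → (ℝ × ℝ) × (ℝ × ℝ)`, `(r, v) ↦ ((v 0, r), (v 1, v 2))`
(the time direction is inserted as the second coordinate). [folklore] -/
def ρ : ℝ × 𝔼 3 →L[ℝ] (ℝ × ℝ) × (ℝ × ℝ) :=
  jmap.comp (ContinuousLinearMap.snd ℝ ℝ (𝔼 3)) +
    (ContinuousLinearMap.fst ℝ ℝ (𝔼 3)).smulRight ((((0 : ℝ), (1 : ℝ)), ((0 : ℝ), (0 : ℝ))))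

/-- Evaluation of `ρ`. [folklore] -/
@[simp]
theorem ρ_apply (q : ℝ × 𝔼 3) : ρ q = ((q.2 0, q.1), (q.2 1, q.2 2)) := by
  simp [ρ]

/-- `ρ` is injective. [folklore] -/
theorem injective_ρ : Injective ρ := by
  intro q q' hq
  simp only [ρ_apply, Prod.mk.injEq] at hq
  refine Prod.ext hq.1.2 ?_
  ext i
  fin_cases i
  · exact hq.1.1
  · exact hq.2.1
  · exact hq.2.2

/-- **The lower end chart** `ĉ₁ x = tube ((x 0, 1), (x 1, x 2))`. [folklore] -/
def c₁ (x : 𝔼 3) : 𝔼 4 := (h.setup w).tube (mpt 1 x)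

/-- **The upper end chart** `ĉ₂ x = ½ • tube ((x 0, 2), (x 1, x 2))`. [folklore] -/
def c₂ (x : 𝔼 3) : 𝔼 4 := (1 / 2 : ℝ) • (h.setup w).tube (mpt 2 x)

/-- `1 ≤ 1 + δ/4` in the form used by the tube lemmas. [folklore] -/
theorem one_le : (1 : ℝ) ≤ 1 + (h.setup w).δ / 4 := by
  have := h.δ_pos; simp only [setup_δ]; linarith

/-- `2 - δ/4 ≤ 2` in the form used by the tube lemmas. [folklore] -/
theorem le_two : 2 - (h.setup w).δ / 4 ≤ (2 : ℝ) := by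
  have := h.δ_pos; simp only [setup_δ]; linarith

/-- The lower end chart has unit norm. [folklore] -/
theorem norm_c₁ (x : 𝔼 3) : ‖h.c₁ w x‖ = 1 := by
  rw [c₁, mpt, (h.setup w).norm_tube_of_le (h.one_le w), abs_one]

/-- The upper end chart has unit norm. [folklore] -/
theorem norm_c₂ (x : 𝔼 3) : ‖h.c₂ w x‖ = 1 := by
  rw [c₂, mpt, norm_smul, (h.setup w).norm_tube_of_ge (h.le_two w)]
  norm_num

/-- The lower end chart is `C^∞`. [folklore] -/
theorem contDiff_c₁ : ContDiff ℝ ∞ (h.c₁ w) := (h.setup w).contDiff_tube.comp (contDiff_mpt 1)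

/-- The upper end chart is `C^∞`. [folklore] -/
theorem contDiff_c₂ : ContDiff ℝ ∞ (h.c₂ w) := by
  have h1 : ContDiff ℝ ∞ fun x ↦ (h.setup w).tube (mpt 2 x) :=
    (h.setup w).contDiff_tube.comp (contDiff_mpt 2)
  exact (contDiff_const (c := (1 / 2 : ℝ))).smul h1

/-- **Near the lower end the tube is the cone over the lower end chart**:
`tube ((x 0, t), (x 1, x 2)) = t • ĉ₁ x` for `t ≤ 1 + δ/4`. [folklore] -/
theorem tube_mpt_of_le {t : ℝ} (ht : t ≤ 1 + δ / 4) (x : 𝔼 3) :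
    (h.setup w).tube (mpt t x) = t • h.c₁ w x := by
  rw [c₁, mpt, mpt, (h.setup w).tube_of_le (show t ≤ 1 + (h.setup w).δ / 4 from ht),
    (h.setup w).tube_of_le (h.one_le w)]
  simp [TubeSetup.coneTube, TubeSetup.coneAff]

/-- **Near the upper end the tube is the cone over the upper end chart**:
`tube ((x 0, t), (x 1, x 2)) = t • ĉ₂ x` for `t ≥ 2 - δ/4`. [folklore] -/
theorem tube_mpt_of_ge {t : ℝ} (ht : 2 - δ / 4 ≤ t) (x : 𝔼 3) :
    (h.setup w).tube (mpt t x) = t • h.c₂ w x := by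
  rw [c₂, mpt, mpt, (h.setup w).tube_of_ge (show 2 - (h.setup w).δ / 4 ≤ t from ht),
    (h.setup w).tube_of_ge (h.le_two w)]
  simp only [TubeSetup.coneTube, TubeSetup.coneAff, smul_smul]
  congr 1
  ring

/-! ### Derivatives of the end charts and the time derivative of the tube -/

/-- The derivative of the lower end chart: `D tube ∘ jmap`. [folklore] -/
theorem hasFDerivAt_c₁ (x : 𝔼 3) :
    HasFDerivAt (h.c₁ w) ((fderiv ℝ (h.setup w).tube (mpt 1 x)).comp jmap) x :=
  (((h.setup w).contDiff_tube.differentiable (by simp)) _).hasFDerivAt.comp x (hasFDerivAt_mpt 1 x)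

/-- The derivative of the upper end chart: `½ • D tube ∘ jmap`. [folklore] -/
theorem hasFDerivAt_c₂ (x : 𝔼 3) :
    HasFDerivAt (h.c₂ w) ((1 / 2 : ℝ) • (fderiv ℝ (h.setup w).tube (mpt 2 x)).comp jmap) x := by
  have h1 : HasFDerivAt (fun x ↦ (h.setup w).tube (mpt 2 x))
      ((fderiv ℝ (h.setup w).tube (mpt 2 x)).comp jmap) x :=
    (((h.setup w).contDiff_tube.differentiable (by simp)) _).hasFDerivAt.comp x (hasFDerivAt_mpt 2 x)
  exact h1.const_smul (1 / 2 : ℝ)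

/-- The time direction in model coordinates. [folklore] -/
def eT : (ℝ × ℝ) × (ℝ × ℝ) := (((0 : ℝ), (1 : ℝ)), ((0 : ℝ), (0 : ℝ)))

/-- The path `s ↦ mpt s x` has velocity `eT`. [folklore] -/
theorem hasDerivAt_mpt (x : 𝔼 3) (s : ℝ) : HasDerivAt (fun s ↦ mpt s x) eT s := by
  have h1 : HasDerivAt (fun s : ℝ ↦ ((x 0, s) : ℝ × ℝ)) ((0 : ℝ), (1 : ℝ)) s :=
    (hasDerivAt_const s (x 0)).prodMk (hasDerivAt_id s)
  have h2 : HasDerivAt (fun _ : ℝ ↦ ((x 1, x 2) : ℝ × ℝ)) (0 : ℝ × ℝ) s :=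
    hasDerivAt_const s ((x 1, x 2) : ℝ × ℝ)
  exact h1.prodMk h2

/-- **The time derivative of the tube at the lower end is the lower end chart**:
`D tube (mpt 1 x) eT = ĉ₁ x`. [folklore] -/
theorem fderiv_tube_eT_one (x : 𝔼 3) : fderiv ℝ (h.setup w).tube (mpt 1 x) eT = h.c₁ w x := by
  have hd := ((h.setup w).contDiff_tube.differentiable (by simp)) (mpt 1 x)
  -- chain rule along the time path
  have h1 := hd.hasFDerivAt.comp_hasDerivAt (1 : ℝ) (hasDerivAt_mpt x 1)
  -- near `s = 1` the path is the cone `s • ĉ₁ x`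
  have h2 : HasDerivAt (fun s ↦ (h.setup w).tube (mpt s x)) (h.c₁ w x) 1 := by
    have hev : (fun s ↦ (h.setup w).tube (mpt s x)) =ᶠ[𝓝 1] fun s ↦ s • h.c₁ w x := by
      filter_upwards [Iio_mem_nhds (show (1 : ℝ) < 1 + δ / 4 by linarith [h.δ_pos])] with s hs
      exact h.tube_mpt_of_le w hs.le x
    refine HasDerivAt.congr_of_eventuallyEq ?_ hev
    simpa using (hasDerivAt_id (1 : ℝ)).smul_const (h.c₁ w x)
  exact h1.unique h2

/-- **The time derivative of the tube at the upper end is the upper end chart**: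
`D tube (mpt 2 x) eT = ĉ₂ x`. [folklore] -/
theorem fderiv_tube_eT_two (x : 𝔼 3) : fderiv ℝ (h.setup w).tube (mpt 2 x) eT = h.c₂ w x := by
  have hd := ((h.setup w).contDiff_tube.differentiable (by simp)) (mpt 2 x)
  have h1 := hd.hasFDerivAt.comp_hasDerivAt (2 : ℝ) (hasDerivAt_mpt x 2)
  have h2 : HasDerivAt (fun s ↦ (h.setup w).tube (mpt s x)) (h.c₂ w x) 2 := by
    have hev : (fun s ↦ (h.setup w).tube (mpt s x)) =ᶠ[𝓝 2] fun s ↦ s • h.c₂ w x := by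
      filter_upwards [Ioi_mem_nhds (show (2 : ℝ) - δ / 4 < 2 by linarith [h.δ_pos])] with s hs
      exact h.tube_mpt_of_ge w hs.le x
    refine HasDerivAt.congr_of_eventuallyEq ?_ hev
    simpa using (hasDerivAt_id (2 : ℝ)).smul_const (h.c₂ w x)
  exact h1.unique h2

/-- **The frame of the tube derivative at level `t`**: with `T = D tube (mpt t x) eT` and
`N = D tube (mpt t x) ∘ jmap` one has `frame T N = D tube (mpt t x) ∘ ρ`. [folklore] -/
theorem frame_fderiv_tube (t : ℝ) (x : 𝔼 3) :
    frame (fderiv ℝ (h.setup w).tube (mpt t x) eT) ((fderiv ℝ (h.setup w).tube (mpt t x)).comp jmap) =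
      (fderiv ℝ (h.setup w).tube (mpt t x)).comp ρ := by
  refine ContinuousLinearMap.ext fun q ↦ ?_
  rw [frame_apply, ContinuousLinearMap.coe_comp, comp_apply, ContinuousLinearMap.coe_comp,
    comp_apply, ← map_smul, ← map_add]
  congr 1
  simp only [ρ_apply, jmap_apply, eT, Prod.smul_mk, Prod.mk_add_mk, smul_eq_mul, mul_one,
    mul_zero, zero_add, add_zero]

/-- The lower end frame is the tube frame at level `1`. [folklore] -/
theorem frame_c₁ (x : 𝔼 3) :
    frame (h.c₁ w x) (fderiv ℝ (h.c₁ w) x) = (fderiv ℝ (h.setup w).tube (mpt 1 x)).comp ρ := by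
  rw [(h.hasFDerivAt_c₁ w x).fderiv, ← h.fderiv_tube_eT_one w x, frame_fderiv_tube]

/-- The upper end frame, with columns doubled, is the tube frame at level `2`. [folklore] -/
theorem frame_c₂ (x : 𝔼 3) :
    frame (h.c₂ w x) ((fderiv ℝ (h.c₂ w) x).comp ((2 : ℝ) • ContinuousLinearMap.id ℝ (𝔼 3))) =
      (fderiv ℝ (h.setup w).tube (mpt 2 x)).comp ρ := by
  have h2 : (fderiv ℝ (h.c₂ w) x).comp ((2 : ℝ) • ContinuousLinearMap.id ℝ (𝔼 3)) =
      (fderiv ℝ (h.setup w).tube (mpt 2 x)).comp jmap := by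
    rw [(h.hasFDerivAt_c₂ w x).fderiv]
    ext v : 1
    simp [smul_smul]
  rw [h2, ← h.fderiv_tube_eT_two w x, frame_fderiv_tube]

/-! ### The chart region and injectivity -/

/-- The **chart region**: model points over the open strip and inside the radius. [folklore] -/
def region (θ₀ η ε : ℝ) : Set (𝔼 3) :=
  {x | x 0 ∈ Ioo (θ₀ - η) (θ₀ + η) ∧ ((x 1, x 2) : ℝ × ℝ) ∈ ball (0 : ℝ × ℝ) ε}

/-- The chart region is open. [folklore] -/
theorem isOpen_region (θ₀ η ε : ℝ) : IsOpen (region θ₀ η ε) := by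
  have h0 : Continuous fun x : 𝔼 3 ↦ x 0 := (EuclideanSpace.proj (0 : Fin 3)).continuous
  have h12 : Continuous fun x : 𝔼 3 ↦ ((x 1, x 2) : ℝ × ℝ) :=
    (EuclideanSpace.proj (1 : Fin 3)).continuous.prodMk (EuclideanSpace.proj (2 : Fin 3)).continuous
  exact (isOpen_Ioo.preimage h0).inter (isOpen_ball.preimage h12)

variable {w} {θ₀ η ε : ℝ}

/-- Model points of the region lie in the domain of the good tube, at any level `t ∈ [1, 2]`.
[folklore] -/
theorem mpt_mem {x : 𝔼 3} (hx : x ∈ region θ₀ η ε) {t : ℝ} (ht : t ∈ Icc (1 : ℝ) 2) :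
    mpt t x ∈ (Icc (θ₀ - η) (θ₀ + η) ×ˢ Icc (1 : ℝ) 2) ×ˢ ball (0 : ℝ × ℝ) ε :=
  mk_mem_prod (mk_mem_prod (Ioo_subset_Icc_self hx.1) ht) hx.2

/-- **The lower end chart is injective on the region.** [folklore] -/
theorem injOn_c₁ (G : (h.setup w).GoodTube θ₀ η ε) : InjOn (h.c₁ w) (region θ₀ η ε) := by
  intro x hx x' hx' he
  have := G.injOn (mpt_mem hx ⟨le_rfl, by norm_num⟩) (mpt_mem hx' ⟨le_rfl, by norm_num⟩) he
  simp only [mpt, Prod.mk.injEq] at this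
  ext i; fin_cases i
  · exact this.1.1
  · exact this.2.1
  · exact this.2.2

/-- **The upper end chart is injective on the region.** [folklore] -/
theorem injOn_c₂ (G : (h.setup w).GoodTube θ₀ η ε) : InjOn (h.c₂ w) (region θ₀ η ε) := by
  intro x hx x' hx' he
  have he' : (h.setup w).tube (mpt 2 x) = (h.setup w).tube (mpt 2 x') :=
    smul_right_injective (𝔼 4) (by norm_num : (1 / 2 : ℝ) ≠ 0) he
  have := G.injOn (mpt_mem hx ⟨by norm_num, le_rfl⟩) (mpt_mem hx' ⟨by norm_num, le_rfl⟩) he'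
  simp only [mpt, Prod.mk.injEq] at this
  ext i; fin_cases i
  · exact this.1.1
  · exact this.2.1
  · exact this.2.2

/-- **The lower end chart is an immersion on the region.** [folklore] -/
theorem injective_fderiv_c₁ (G : (h.setup w).GoodTube θ₀ η ε) {x : 𝔼 3} (hx : x ∈ region θ₀ η ε) :
    Injective (fderiv ℝ (h.c₁ w) x) := by
  rw [(h.hasFDerivAt_c₁ w x).fderiv, ContinuousLinearMap.coe_comp]
  exact (G.injective_fderiv _ (mpt_mem hx ⟨le_rfl, by norm_num⟩)).comp injective_jmap

/-- **The upper end chart is an immersion on the region.** [folklore] -/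
theorem injective_fderiv_c₂ (G : (h.setup w).GoodTube θ₀ η ε) {x : 𝔼 3} (hx : x ∈ region θ₀ η ε) :
    Injective (fderiv ℝ (h.c₂ w) x) := by
  rw [(h.hasFDerivAt_c₂ w x).fderiv]
  intro v v' hv
  have hv' : ((fderiv ℝ (h.setup w).tube (mpt 2 x)).comp jmap) v =
      ((fderiv ℝ (h.setup w).tube (mpt 2 x)).comp jmap) v' := by
    have := smul_right_injective (𝔼 4) (by norm_num : (1 / 2 : ℝ) ≠ 0) hv
    exact this
  exact (G.injective_fderiv _ (mpt_mem hx ⟨by norm_num, le_rfl⟩)).comp injective_jmap hv'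

/-! ### The two end charts have the same orientation -/

/-- **The frame determinants of the two end charts have the same sign** at every point of
the region: both are values (at `t = 1`, and at `t = 2` up to the positive factor `det (2 id)`)
of the frame determinant of the tube frame `(D tube (mpt t x) eT, D tube (mpt t x) ∘ jmap)`,
which is a frame for all `t ∈ [1, 2]` (`GoodTube.injective_fderiv`) and depends continuously on
`t` (`CircleFraming.frameDet_pos_iff_of_isPreconnected`). [folklore] -/
theorem frameDet_c₁_pos_iff (G : (h.setup w).GoodTube θ₀ η ε) {x : 𝔼 3} (hx : x ∈ region θ₀ η ε) :
    (0 < CircleFraming.frameDet R₄ (h.c₁ w x) (fderiv ℝ (h.c₁ w) x)) ↔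
      0 < CircleFraming.frameDet R₄ (h.c₂ w x) (fderiv ℝ (h.c₂ w) x) := by
  set Dt : ℝ → ((ℝ × ℝ) × (ℝ × ℝ)) →L[ℝ] 𝔼 4 := fun t ↦ fderiv ℝ (h.setup w).tube (mpt t x) with hDt
  have hDc : Continuous Dt := ((h.setup w).contDiff_tube.continuous_fderiv (by simp)).comp
    ((continuous_const.prodMk continuous_id).prodMk continuous_const)
  have hT : ContinuousOn (fun t ↦ Dt t eT) (Icc (1 : ℝ) 2) := (hDc.clm_apply continuous_const).continuousOn
  have hN : ContinuousOn (fun t ↦ (Dt t).comp jmap) (Icc (1 : ℝ) 2) :=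
    (hDc.clm_comp continuous_const).continuousOn
  have hframe : ∀ t ∈ Icc (1 : ℝ) 2, IsFrame (Dt t eT) ((Dt t).comp jmap) := by
    intro t ht
    have hinj := G.injective_fderiv _ (mpt_mem hx ht)
    refine (isFrame_iff (by simp)).2 ⟨?_, ?_⟩
    · rw [hDt]; simp only; rw [ContinuousLinearMap.coe_comp]
      exact hinj.comp injective_jmap
    · rintro ⟨v, hv⟩
      rw [hDt] at hv
      simp only [ContinuousLinearMap.coe_comp, comp_apply] at hv
      have := congrArg (fun q : (ℝ × ℝ) × (ℝ × ℝ) ↦ q.1.2) (hinj hv)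
      simp [eT] at this
  have key := frameDet_pos_iff_of_isPreconnected R₄ isPreconnected_Icc hT hN hframe
    (x := 1) (y := 2) ⟨le_rfl, by norm_num⟩ ⟨by norm_num, le_rfl⟩
  -- identify the end values
  have e1 : CircleFraming.frameDet R₄ (Dt 1 eT) ((Dt 1).comp jmap) = CircleFraming.frameDet R₄ (h.c₁ w x) (fderiv ℝ (h.c₁ w) x) := by
    rw [hDt]; simp only; rw [h.fderiv_tube_eT_one w x, (h.hasFDerivAt_c₁ w x).fderiv]
  have e2 : CircleFraming.frameDet R₄ (Dt 2 eT) ((Dt 2).comp jmap) =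
      CircleFraming.frameDet R₄ (h.c₂ w x) (fderiv ℝ (h.c₂ w) x) * ((2 : ℝ) • ContinuousLinearMap.id ℝ (𝔼 3)).det := by
    rw [← frameDet_comp_right, hDt]; simp only
    rw [h.fderiv_tube_eT_two w x, (h.hasFDerivAt_c₂ w x).fderiv]
    congr 1
    ext v : 1
    simp [smul_smul]
  have h8 : ((2 : ℝ) • ContinuousLinearMap.id ℝ (𝔼 3)).det = 8 := by
    change LinearMap.det ((2 : ℝ) • (LinearMap.id : (𝔼 3) →ₗ[ℝ] 𝔼 3)) = 8
    rw [LinearMap.det_smul, LinearMap.det_id, finrank_euclideanSpace_fin]; norm_num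
  rw [e1, e2, h8] at key
  rw [key]
  constructor
  · intro hp; nlinarith
  · intro hp; nlinarith

/-- The lower end frame is a frame on the region. [folklore] -/
theorem frameDet_c₁_ne_zero (G : (h.setup w).GoodTube θ₀ η ε) {x : 𝔼 3} (hx : x ∈ region θ₀ η ε) :
    CircleFraming.frameDet R₄ (h.c₁ w x) (fderiv ℝ (h.c₁ w) x) ≠ 0 := by
  refine (isFrame_iff_frameDet_ne_zero R₄).1 (isFrame_of_inner_eq_zero (S := h.c₁ w x) (by simp)
    (h.injective_fderiv_c₁ G hx) (fun v ↦ ?_) ?_)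
  · -- unit norm: the derivative is orthogonal to the value
    have hd := ((h.contDiff_c₁ w).differentiable (by simp)) x
    have h1 : HasFDerivAt (fun x ↦ ‖h.c₁ w x‖ ^ 2)
        (2 • (innerSL ℝ (h.c₁ w x)).comp (fderiv ℝ (h.c₁ w) x)) x := hd.hasFDerivAt.norm_sq
    have h2 : HasFDerivAt (fun x ↦ ‖h.c₁ w x‖ ^ 2) (0 : (𝔼 3) →L[ℝ] ℝ) x := by
      have : (fun x ↦ ‖h.c₁ w x‖ ^ 2) = fun _ ↦ (1 : ℝ) := by funext x; rw [norm_c₁, one_pow]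
      rw [this]; exact hasFDerivAt_const 1 x
    have := congrArg (fun L : (𝔼 3) →L[ℝ] ℝ ↦ L v) (h1.unique h2)
    simp [innerSL_apply_apply] at this
    exact this
  · rw [real_inner_self_eq_norm_sq, norm_c₁]; norm_num

/-- The upper end frame is a frame on the region. [folklore] -/
theorem frameDet_c₂_ne_zero (G : (h.setup w).GoodTube θ₀ η ε) {x : 𝔼 3} (hx : x ∈ region θ₀ η ε) :
    CircleFraming.frameDet R₄ (h.c₂ w x) (fderiv ℝ (h.c₂ w) x) ≠ 0 := by
  refine (isFrame_iff_frameDet_ne_zero R₄).1 (isFrame_of_inner_eq_zero (S := h.c₂ w x) (by simp)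
    (h.injective_fderiv_c₂ G hx) (fun v ↦ ?_) ?_)
  · have hd := ((h.contDiff_c₂ w).differentiable (by simp)) x
    have h1 : HasFDerivAt (fun x ↦ ‖h.c₂ w x‖ ^ 2)
        (2 • (innerSL ℝ (h.c₂ w x)).comp (fderiv ℝ (h.c₂ w) x)) x := hd.hasFDerivAt.norm_sq
    have h2 : HasFDerivAt (fun x ↦ ‖h.c₂ w x‖ ^ 2) (0 : (𝔼 3) →L[ℝ] ℝ) x := by
      have : (fun x ↦ ‖h.c₂ w x‖ ^ 2) = fun _ ↦ (1 : ℝ) := by funext x; rw [norm_c₂, one_pow]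
      rw [this]; exact hasFDerivAt_const 1 x
    have := congrArg (fun L : (𝔼 3) →L[ℝ] ℝ ↦ L v) (h1.unique h2)
    simp [innerSL_apply_apply] at this
    exact this
  · rw [real_inner_self_eq_norm_sq, norm_c₂]; norm_num

/-! ### The end charts read through the stereographic chart -/

variable (w)

/-- The lower end chart lands on the unit sphere. [folklore] -/
theorem mem_sphere_c₁ (x : 𝔼 3) : h.c₁ w x ∈ sphere (0 : 𝔼 4) 1 := by
  rw [mem_sphere_zero_iff_norm, norm_c₁]

/-- The upper end chart lands on the unit sphere. [folklore] -/
theorem mem_sphere_c₂ (x : 𝔼 3) : h.c₂ w x ∈ sphere (0 : 𝔼 4) 1 := by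
  rw [mem_sphere_zero_iff_norm, norm_c₂]

/-- The lower end chart as a map into `𝕊³`. [folklore] -/
def cS₁ : (𝔼 3) → 𝕊 3 := Set.codRestrict (h.c₁ w) _ (h.mem_sphere_c₁ w)

/-- The upper end chart as a map into `𝕊³`. [folklore] -/
def cS₂ : (𝔼 3) → 𝕊 3 := Set.codRestrict (h.c₂ w) _ (h.mem_sphere_c₂ w)

/-- Values of `cS₁`. [folklore] -/
@[simp] theorem coe_cS₁ (x : 𝔼 3) : ((h.cS₁ w x : 𝕊 3) : 𝔼 4) = h.c₁ w x := rfl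

/-- Values of `cS₂`. [folklore] -/
@[simp] theorem coe_cS₂ (x : 𝔼 3) : ((h.cS₂ w x : 𝕊 3) : 𝔼 4) = h.c₂ w x := rfl

/-- `cS₁` is smooth. [folklore] -/
theorem contMDiff_cS₁ : ContMDiff 𝓘(ℝ, 𝔼 3) (𝓡 3) ∞ (h.cS₁ w) :=
  (h.contDiff_c₁ w).contMDiff.codRestrict_sphere _

/-- `cS₂` is smooth. [folklore] -/
theorem contMDiff_cS₂ : ContMDiff 𝓘(ℝ, 𝔼 3) (𝓡 3) ∞ (h.cS₂ w) :=
  (h.contDiff_c₂ w).contMDiff.codRestrict_sphere _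

/-- **The lower end chart read in `ψ`**: `g₁ = ψ ∘ cS₁`. [folklore] -/
def g₁ (x : 𝔼 3) : 𝔼 3 := psi (h.cS₁ w x)

/-- **The upper end chart read in `ψ`**: `g₂ = ψ ∘ cS₂`. [folklore] -/
def g₂ (x : 𝔼 3) : 𝔼 3 := psi (h.cS₂ w x)

/-- The domain of `g₁`: points whose image is not the south pole. [folklore] -/
def W₁ : Set (𝔼 3) := {x | h.cS₁ w x ≠ southPole}

/-- The domain of `g₂`. [folklore] -/
def W₂ : Set (𝔼 3) := {x | h.cS₂ w x ≠ southPole}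

/-- `W₁` is open. [folklore] -/
theorem isOpen_W₁ : IsOpen (h.W₁ w) :=
  isOpen_compl_singleton.preimage (h.contMDiff_cS₁ w).continuous

/-- `W₂` is open. [folklore] -/
theorem isOpen_W₂ : IsOpen (h.W₂ w) :=
  isOpen_compl_singleton.preimage (h.contMDiff_cS₂ w).continuous

/-- `g₁` is `C^∞` on `W₁`. [folklore] -/
theorem contDiffOn_g₁ : ContDiffOn ℝ ∞ (h.g₁ w) (h.W₁ w) := by
  have h1 : ContMDiffOn 𝓘(ℝ, 𝔼 3) (𝓡 3) ∞ (h.g₁ w) (h.W₁ w) :=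
    contMDiffOn_psi.comp (h.contMDiff_cS₁ w).contMDiffOn fun x hx ↦ mem_psi_source hx
  rw [← contMDiffOn_iff_contDiffOn]
  exact h1

/-- `g₂` is `C^∞` on `W₂`. [folklore] -/
theorem contDiffOn_g₂ : ContDiffOn ℝ ∞ (h.g₂ w) (h.W₂ w) := by
  have h1 : ContMDiffOn 𝓘(ℝ, 𝔼 3) (𝓡 3) ∞ (h.g₂ w) (h.W₂ w) :=
    contMDiffOn_psi.comp (h.contMDiff_cS₂ w).contMDiffOn fun x hx ↦ mem_psi_source hx
  rw [← contMDiffOn_iff_contDiffOn]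
  exact h1

variable {w}

/-- `φ ∘ g₁ = ĉ₁` on `W₁`. [folklore] -/
theorem phi_g₁ {x : 𝔼 3} (hx : x ∈ h.W₁ w) : phi (h.g₁ w x) = h.c₁ w x := by
  rw [phi, g₁, psi_symm_apply_psi hx, coe_cS₁]

/-- `φ ∘ g₂ = ĉ₂` on `W₂`. [folklore] -/
theorem phi_g₂ {x : 𝔼 3} (hx : x ∈ h.W₂ w) : phi (h.g₂ w x) = h.c₂ w x := by
  rw [phi, g₂, psi_symm_apply_psi hx, coe_cS₂]

/-- `φ ∘ g₁ = ĉ₁` near a point of `W₁`. [folklore] -/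
theorem phi_comp_g₁ {x : 𝔼 3} (hx : x ∈ h.W₁ w) : phi ∘ h.g₁ w =ᶠ[𝓝 x] h.c₁ w := by
  filter_upwards [(h.isOpen_W₁ w).mem_nhds hx] with y hy
  exact h.phi_g₁ hy

/-- `φ ∘ g₂ = ĉ₂` near a point of `W₂`. [folklore] -/
theorem phi_comp_g₂ {x : 𝔼 3} (hx : x ∈ h.W₂ w) : phi ∘ h.g₂ w =ᶠ[𝓝 x] h.c₂ w := by
  filter_upwards [(h.isOpen_W₂ w).mem_nhds hx] with y hy
  exact h.phi_g₂ hy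

/-- `g₁` is differentiable at points of `W₁`. [folklore] -/
theorem differentiableAt_g₁ {x : 𝔼 3} (hx : x ∈ h.W₁ w) : DifferentiableAt ℝ (h.g₁ w) x :=
  ((h.contDiffOn_g₁ w).contDiffAt ((h.isOpen_W₁ w).mem_nhds hx)).differentiableAt (by simp)

/-- `g₂` is differentiable at points of `W₂`. [folklore] -/
theorem differentiableAt_g₂ {x : 𝔼 3} (hx : x ∈ h.W₂ w) : DifferentiableAt ℝ (h.g₂ w) x :=
  ((h.contDiffOn_g₂ w).contDiffAt ((h.isOpen_W₂ w).mem_nhds hx)).differentiableAt (by simp)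

/-- The chain rule `Dĉ₁ = Dφ ∘ Dg₁`. [folklore] -/
theorem fderiv_c₁_eq {x : 𝔼 3} (hx : x ∈ h.W₁ w) :
    fderiv ℝ (h.c₁ w) x = (fderiv ℝ phi (h.g₁ w x)).comp (fderiv ℝ (h.g₁ w) x) := by
  rw [← (h.phi_comp_g₁ hx).fderiv_eq]
  exact fderiv_comp x ((contDiff_phi.differentiable (by simp)) _) (h.differentiableAt_g₁ hx)

/-- The chain rule `Dĉ₂ = Dφ ∘ Dg₂`. [folklore] -/
theorem fderiv_c₂_eq {x : 𝔼 3} (hx : x ∈ h.W₂ w) :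
    fderiv ℝ (h.c₂ w) x = (fderiv ℝ phi (h.g₂ w x)).comp (fderiv ℝ (h.g₂ w) x) := by
  rw [← (h.phi_comp_g₂ hx).fderiv_eq]
  exact fderiv_comp x ((contDiff_phi.differentiable (by simp)) _) (h.differentiableAt_g₂ hx)

/-- **`g₁` is a local diffeomorphism on the region**: its derivative is injective. [folklore] -/
theorem injective_fderiv_g₁ (G : (h.setup w).GoodTube θ₀ η ε) {x : 𝔼 3} (hx : x ∈ region θ₀ η ε)
    (hxW : x ∈ h.W₁ w) : Injective (fderiv ℝ (h.g₁ w) x) := by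
  have hinj := h.injective_fderiv_c₁ G hx
  rw [h.fderiv_c₁_eq hxW, ContinuousLinearMap.coe_comp] at hinj
  exact hinj.of_comp

/-- **`g₂` is a local diffeomorphism on the region.** [folklore] -/
theorem injective_fderiv_g₂ (G : (h.setup w).GoodTube θ₀ η ε) {x : 𝔼 3} (hx : x ∈ region θ₀ η ε)
    (hxW : x ∈ h.W₂ w) : Injective (fderiv ℝ (h.g₂ w) x) := by
  have hinj := h.injective_fderiv_c₂ G hx
  rw [h.fderiv_c₂_eq hxW, ContinuousLinearMap.coe_comp] at hinj
  exact hinj.of_comp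

/-- An injective endomorphism of `ℝ³` as a continuous linear automorphism. [folklore] -/
def equivOfInjective (A : (𝔼 3) →L[ℝ] 𝔼 3) (hA : Injective A) : (𝔼 3) ≃L[ℝ] 𝔼 3 :=
  (LinearEquiv.ofInjectiveEndo (A : (𝔼 3) →ₗ[ℝ] 𝔼 3) hA).toContinuousLinearEquiv

/-- The automorphism is the given map. [folklore] -/
@[simp]
theorem coe_equivOfInjective (A : (𝔼 3) →L[ℝ] 𝔼 3) (hA : Injective A) :
    (equivOfInjective A hA : (𝔼 3) →L[ℝ] 𝔼 3) = A := by
  ext x : 1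
  rfl

/-- **The Jacobians of `g₁` and `g₂` have the same sign** at every point of the region (same
orientation of the end charts, `frameDet_c₁_pos_iff`, and constant orientation sign of the
chart, `frameDet_phi_pos_iff`). [folklore] -/
theorem det_fderiv_g₁_mul_pos (G : (h.setup w).GoodTube θ₀ η ε) {x : 𝔼 3} (hx : x ∈ region θ₀ η ε)
    (h₁ : x ∈ h.W₁ w) (h₂ : x ∈ h.W₂ w) :
    0 < (fderiv ℝ (h.g₁ w) x).det * (fderiv ℝ (h.g₂ w) x).det := by
  have e1 := frameDet_eq_mul_det (h.differentiableAt_g₁ h₁) (h.phi_comp_g₁ h₁)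
  have e2 := frameDet_eq_mul_det (h.differentiableAt_g₂ h₂) (h.phi_comp_g₂ h₂)
  -- the chart factors have the same sign, the chart-end frames have the same sign
  have hP := mul_pos_of_pos_iff (frameDet_phi_pos_iff (h.g₁ w x) (h.g₂ w x))
    (frameDet_phi_ne_zero _) (frameDet_phi_ne_zero _)
  have hF := mul_pos_of_pos_iff (h.frameDet_c₁_pos_iff G hx) (h.frameDet_c₁_ne_zero G hx)
    (h.frameDet_c₂_ne_zero G hx)
  rw [e1, e2] at hF
  set P₁ := CircleFraming.frameDet R₄ (phi (h.g₁ w x)) (fderiv ℝ phi (h.g₁ w x))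
  set P₂ := CircleFraming.frameDet R₄ (phi (h.g₂ w x)) (fderiv ℝ phi (h.g₂ w x))
  set d₁ := (fderiv ℝ (h.g₁ w) x).det
  set d₂ := (fderiv ℝ (h.g₂ w) x).det
  have hF' : 0 < (P₁ * P₂) * (d₁ * d₂) := by nlinarith [hF]
  exact pos_of_mul_pos_right hF' hP.le |> fun h' ↦ by nlinarith [h', hP, hF']

/-! ### Determinants of matrices versus determinants of linear maps -/

/-- `det (toMat A) = det A`. [folklore] -/
theorem det_toMat (A : (𝔼 3) →L[ℝ] 𝔼 3) : (toMat A).det = A.det := by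
  have h1 : ((toCLM (toMat A) : (𝔼 3) →L[ℝ] 𝔼 3) : (𝔼 3) →ₗ[ℝ] 𝔼 3) =
      Matrix.toLin (PiLp.basisFun 2 ℝ (Fin 3)) (PiLp.basisFun 2 ℝ (Fin 3)) (toMat A) := by
    rw [toCLM, Matrix.coe_toEuclideanCLM_eq_toEuclideanLin]
    rfl
  rw [toCLM_toMat] at h1
  rw [ContinuousLinearMap.det, h1, LinearMap.det_toLin]

/-- Determinant of a composite, matrix form. [folklore] -/
theorem det_toMat_comp (A B : (𝔼 3) →L[ℝ] 𝔼 3) :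
    (toMat (A.comp B)).det = (toMat A).det * (toMat B).det := by
  rw [toMat_comp, Matrix.det_mul]

/-- **Transfer of the orientation hypothesis from `g₁` to `g₂`.** [folklore] -/
theorem det_toMat_comp_pos (G : (h.setup w).GoodTube θ₀ η ε) {x : 𝔼 3} (hx : x ∈ region θ₀ η ε)
    (h₁ : x ∈ h.W₁ w) (h₂ : x ∈ h.W₂ w) (M : (𝔼 3) →L[ℝ] 𝔼 3)
    (hM : 0 < (toMat ((fderiv ℝ (h.g₁ w) x).comp M)).det) :
    0 < (toMat ((fderiv ℝ (h.g₂ w) x).comp M)).det := by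
  have hp := h.det_fderiv_g₁_mul_pos G hx h₁ h₂
  rw [det_toMat_comp, det_toMat] at hM ⊢
  have hM' : (toMat M).det ≠ 0 := by
    intro h0; rw [h0, mul_zero] at hM; exact lt_irrefl _ hM
  have : 0 < ((fderiv ℝ (h.g₁ w) x).det * (toMat M).det) * ((fderiv ℝ (h.g₂ w) x).det * (toMat M).det) := by
    have hsq : 0 < (toMat M).det ^ 2 := by positivity
    nlinarith [hp, hsq]
  exact pos_of_mul_pos_right this hM.le |> fun h' ↦ by nlinarith [h', hM, this]

/-! ### Small affine copies of a knot in the end charts -/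

section Tiny

variable (x₀ c : 𝔼 3) (M : (𝔼 3) ≃L[ℝ] 𝔼 3) (l : ℝ)

/-- The **affine contraction** `T z = x₀ + l • M (z - c)` into the chart region. [folklore] -/
def affT (z : 𝔼 3) : 𝔼 3 := x₀ + l • M (z - c)

/-- The affine contraction is `C^∞`. [folklore] -/
theorem contDiff_affT : ContDiff ℝ ∞ (affT x₀ c M l) := by
  have h1 : ContDiff ℝ ∞ fun z : 𝔼 3 ↦ M (z - c) := M.contDiff.comp (contDiff_id.sub contDiff_const)
  show ContDiff ℝ ∞ fun z ↦ x₀ + l • M (z - c)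
  exact contDiff_const.add ((contDiff_const (c := l)).smul h1)

/-- The derivative of the affine contraction. [folklore] -/
theorem hasFDerivAt_affT (z : 𝔼 3) :
    HasFDerivAt (affT x₀ c M l) (l • (M : (𝔼 3) →L[ℝ] 𝔼 3)) z := by
  have h1 : HasFDerivAt (fun z ↦ M (z - c))
      ((M : (𝔼 3) →L[ℝ] 𝔼 3).comp (ContinuousLinearMap.id ℝ (𝔼 3))) z :=
    (M : (𝔼 3) →L[ℝ] 𝔼 3).hasFDerivAt.comp z ((hasFDerivAt_id z).sub_const c)
  rw [ContinuousLinearMap.comp_id] at h1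
  exact (h1.const_smul l).const_add x₀

variable {x₀ c M l}

/-- The affine contraction is injective for `l ≠ 0`. [folklore] -/
theorem injective_affT (hl : l ≠ 0) : Injective (affT x₀ c M l) := by
  intro z z' hz
  simp only [affT, add_right_inj] at hz
  have := smul_right_injective (𝔼 3) hl hz
  simpa using M.injective this

variable (Kn : Knot) (x₀ c M l)

/-- The **small copy of a knot in the lower end chart**, as a curve:
`θ ↦ ĉ₁ (T (ψ (Kn (cos θ, sin θ))))`. [folklore] -/
def tinyCurve₁ (θ : ℝ) : 𝔼 4 := h.c₁ w (affT x₀ c M l (Kn.chartCurve θ))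

/-- The **small copy of a knot in the upper end chart**, as a curve. [folklore] -/
def tinyCurve₂ (θ : ℝ) : 𝔼 4 := h.c₂ w (affT x₀ c M l (Kn.chartCurve θ))

variable {Kn x₀ c M l}

/-- **The small copy in the lower end chart is a regular simple closed curve** when `Kn` is off
the south pole, `l ≠ 0`, and `T` maps the chart image of `Kn` into the region of a good tube.
[folklore] -/
theorem isRegularClosedCurve_tinyCurve₁ (G : (h.setup w).GoodTube θ₀ η ε)
    (hKn : ∀ y, Kn y ≠ southPole) (hl : l ≠ 0)
    (hT : ∀ y, affT x₀ c M l (psi (Kn y)) ∈ region θ₀ η ε) :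
    IsRegularClosedCurve (h.tinyCurve₁ (w := w) x₀ c M l Kn) where
  contDiff := (h.contDiff_c₁ w).comp ((contDiff_affT x₀ c M l).comp (contDiff_chartCurve hKn))
  periodic θ := by
    show h.c₁ w (affT x₀ c M l (Kn.chartCurve (θ + 2 * Real.pi))) = _
    rw [Kn.periodic_chartCurve]; rfl
  norm_eq_one θ := h.norm_c₁ w _
  deriv_ne_zero θ := by
    have hd : HasDerivAt (h.tinyCurve₁ (w := w) x₀ c M l Kn)
        (fderiv ℝ (h.c₁ w) (affT x₀ c M l (Kn.chartCurve θ))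
          ((l • (M : (𝔼 3) →L[ℝ] 𝔼 3)) (deriv Kn.chartCurve θ))) θ := by
      have h1 := ((contDiff_chartCurve hKn).differentiable (by simp) θ).hasDerivAt
      have h2 := (hasFDerivAt_affT x₀ c M l _).comp_hasDerivAt θ h1
      exact (((h.contDiff_c₁ w).differentiable (by simp)) _).hasFDerivAt.comp_hasDerivAt θ h2
    rw [hd.deriv]
    intro h0
    have h1 := h.injective_fderiv_c₁ G (hT (circlePoint θ))
    rw [← Knot.chartCurve_apply] at h1
    have h2 : (l • (M : (𝔼 3) →L[ℝ] 𝔼 3)) (deriv Kn.chartCurve θ) = 0 :=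
      h1 (by rw [h0, map_zero])
    have h2' : l • M (deriv Kn.chartCurve θ) = 0 := h2
    rw [smul_eq_zero] at h2'
    rcases h2' with h2 | h2
    · exact hl h2
    · exact deriv_chartCurve_ne_zero hKn θ (M.injective (by rw [h2, map_zero]))

/-- **The small copy in the upper end chart is a regular simple closed curve.** [folklore] -/
theorem isRegularClosedCurve_tinyCurve₂ (G : (h.setup w).GoodTube θ₀ η ε)
    (hKn : ∀ y, Kn y ≠ southPole) (hl : l ≠ 0)
    (hT : ∀ y, affT x₀ c M l (psi (Kn y)) ∈ region θ₀ η ε) :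
    IsRegularClosedCurve (h.tinyCurve₂ (w := w) x₀ c M l Kn) where
  contDiff := (h.contDiff_c₂ w).comp ((contDiff_affT x₀ c M l).comp (contDiff_chartCurve hKn))
  periodic θ := by
    show h.c₂ w (affT x₀ c M l (Kn.chartCurve (θ + 2 * Real.pi))) = _
    rw [Kn.periodic_chartCurve]; rfl
  norm_eq_one θ := h.norm_c₂ w _
  deriv_ne_zero θ := by
    have hd : HasDerivAt (h.tinyCurve₂ (w := w) x₀ c M l Kn)
        (fderiv ℝ (h.c₂ w) (affT x₀ c M l (Kn.chartCurve θ))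
          ((l • (M : (𝔼 3) →L[ℝ] 𝔼 3)) (deriv Kn.chartCurve θ))) θ := by
      have h1 := ((contDiff_chartCurve hKn).differentiable (by simp) θ).hasDerivAt
      have h2 := (hasFDerivAt_affT x₀ c M l _).comp_hasDerivAt θ h1
      exact (((h.contDiff_c₂ w).differentiable (by simp)) _).hasFDerivAt.comp_hasDerivAt θ h2
    rw [hd.deriv]
    intro h0
    have h1 := h.injective_fderiv_c₂ G (hT (circlePoint θ))
    rw [← Knot.chartCurve_apply] at h1
    have h2 : (l • (M : (𝔼 3) →L[ℝ] 𝔼 3)) (deriv Kn.chartCurve θ) = 0 :=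
      h1 (by rw [h0, map_zero])
    have h2' : l • M (deriv Kn.chartCurve θ) = 0 := h2
    rw [smul_eq_zero] at h2'
    rcases h2' with h2 | h2
    · exact hl h2
    · exact deriv_chartCurve_ne_zero hKn θ (M.injective (by rw [h2, map_zero]))

/-- The small copy in the lower end chart is injective modulo `2π`. [folklore] -/
theorem tinyCurve₁_inj (G : (h.setup w).GoodTube θ₀ η ε) (hKn : ∀ y, Kn y ≠ southPole) (hl : l ≠ 0)
    (hT : ∀ y, affT x₀ c M l (psi (Kn y)) ∈ region θ₀ η ε) (s t : ℝ)
    (he : h.tinyCurve₁ (w := w) x₀ c M l Kn s = h.tinyCurve₁ (w := w) x₀ c M l Kn t) :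
    circlePoint s = circlePoint t := by
  have he' : h.c₁ w (affT x₀ c M l (psi (Kn (circlePoint s)))) =
      h.c₁ w (affT x₀ c M l (psi (Kn (circlePoint t)))) := he
  have h1 := h.injOn_c₁ G (hT (circlePoint s)) (hT (circlePoint t)) he'
  exact (Knot.chartCurve_eq_iff hKn).1 (injective_affT hl h1)

/-- The small copy in the upper end chart is injective modulo `2π`. [folklore] -/
theorem tinyCurve₂_inj (G : (h.setup w).GoodTube θ₀ η ε) (hKn : ∀ y, Kn y ≠ southPole) (hl : l ≠ 0)
    (hT : ∀ y, affT x₀ c M l (psi (Kn y)) ∈ region θ₀ η ε) (s t : ℝ)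
    (he : h.tinyCurve₂ (w := w) x₀ c M l Kn s = h.tinyCurve₂ (w := w) x₀ c M l Kn t) :
    circlePoint s = circlePoint t := by
  have he' : h.c₂ w (affT x₀ c M l (psi (Kn (circlePoint s)))) =
      h.c₂ w (affT x₀ c M l (psi (Kn (circlePoint t)))) := he
  have h1 := h.injOn_c₂ G (hT (circlePoint s)) (hT (circlePoint t)) he'
  exact (Knot.chartCurve_eq_iff hKn).1 (injective_affT hl h1)

/-- **The small copy of `Kn` in the lower end chart, as a knot.** [folklore] -/
def tinyKnot₁ (G : (h.setup w).GoodTube θ₀ η ε) (hKn : ∀ y, Kn y ≠ southPole) (hl : l ≠ 0)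
    (hT : ∀ y, affT x₀ c M l (psi (Kn y)) ∈ region θ₀ η ε) : Knot :=
  (h.isRegularClosedCurve_tinyCurve₁ G hKn hl hT).toKnot (h.tinyCurve₁_inj G hKn hl hT)

/-- **The small copy of `Kn` in the upper end chart, as a knot.** [folklore] -/
def tinyKnot₂ (G : (h.setup w).GoodTube θ₀ η ε) (hKn : ∀ y, Kn y ≠ southPole) (hl : l ≠ 0)
    (hT : ∀ y, affT x₀ c M l (psi (Kn y)) ∈ region θ₀ η ε) : Knot :=
  (h.isRegularClosedCurve_tinyCurve₂ G hKn hl hT).toKnot (h.tinyCurve₂_inj G hKn hl hT)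

/-- Values of the small copy in the lower end chart. [folklore] -/
theorem coe_tinyKnot₁ (G : (h.setup w).GoodTube θ₀ η ε) (hKn : ∀ y, Kn y ≠ southPole) (hl : l ≠ 0)
    (hT : ∀ y, affT x₀ c M l (psi (Kn y)) ∈ region θ₀ η ε) (y : 𝕊 1) :
    ((h.tinyKnot₁ G hKn hl hT y : 𝕊 3) : 𝔼 4) = h.c₁ w (affT x₀ c M l (psi (Kn y))) := by
  obtain ⟨θ, rfl⟩ := circlePoint_surjective y
  rw [tinyKnot₁, IsRegularClosedCurve.coe_toKnot_circlePoint, tinyCurve₁, Knot.chartCurve_apply]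

/-- Values of the small copy in the upper end chart. [folklore] -/
theorem coe_tinyKnot₂ (G : (h.setup w).GoodTube θ₀ η ε) (hKn : ∀ y, Kn y ≠ southPole) (hl : l ≠ 0)
    (hT : ∀ y, affT x₀ c M l (psi (Kn y)) ∈ region θ₀ η ε) (y : 𝕊 1) :
    ((h.tinyKnot₂ G hKn hl hT y : 𝕊 3) : 𝔼 4) = h.c₂ w (affT x₀ c M l (psi (Kn y))) := by
  obtain ⟨θ, rfl⟩ := circlePoint_surjective y
  rw [tinyKnot₂, IsRegularClosedCurve.coe_toKnot_circlePoint, tinyCurve₂, Knot.chartCurve_apply]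

/-- **Small copies of a knot in the two end charts of a good tube are isotopic to the knot.**
Let `G` be a good tube, `x₀` a point of its chart region at which neither end chart hits the
south pole, `Kn` a knot off the south pole, `M` a linear automorphism compatible with the
orientation of the lower end chart read in `ψ` (`det (Dg₁(x₀) M) > 0`), and `c` a centre. Then
for all sufficiently small `l > 0` the affine contraction `T z = x₀ + l M (z - c)` maps
`ψ ∘ Kn` into the region, and both re-embedded copies `ĉ₁ ∘ T ∘ ψ ∘ Kn`, `ĉ₂ ∘ T ∘ ψ ∘ Kn` are
knots ambient isotopic to `Kn`: the composite `gᵢ ∘ T` is on `ψ (range Kn)` the time-one map of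
a compactly supported ambient isotopy of `ℝ³` (`exists_ambientIsotopy_comp_affine`; the
orientation hypothesis for `g₂` follows from that for `g₁`, `det_toMat_comp_pos`), transported to
`𝕊³` along `ψ` (`AmbientIsotopy.alongChart`). Hirsch (1976), Ch. 8 §1 Thm. 1.4, §3 Thm. 3.1.
[cite: HirschDT1976, Ch. 8 §3, Thm. 3.1 (proof)] -/
theorem exists_isIsotopic_tinyKnot (G : (h.setup w).GoodTube θ₀ η ε) {x₀ : 𝔼 3}
    (hx₀ : x₀ ∈ region θ₀ η ε) (hx₁ : x₀ ∈ h.W₁ w) (hx₂ : x₀ ∈ h.W₂ w)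
    (hKn : ∀ y, Kn y ≠ southPole) (M : (𝔼 3) ≃L[ℝ] 𝔼 3)
    (hM : 0 < (toMat ((fderiv ℝ (h.g₁ w) x₀).comp (M : (𝔼 3) →L[ℝ] 𝔼 3))).det) (c : 𝔼 3) :
    ∃ l₀ : ℝ, 0 < l₀ ∧ ∀ l, ∀ hl : l ∈ Ioo (0 : ℝ) l₀,
      ∃ hT : ∀ y, affT x₀ c M l (psi (Kn y)) ∈ region θ₀ η ε,
        (∀ y, affT x₀ c M l (psi (Kn y)) ∈ h.W₁ w ∩ h.W₂ w) ∧
        Kn.IsIsotopic (h.tinyKnot₁ G hKn hl.1.ne' hT) ∧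
        Kn.IsIsotopic (h.tinyKnot₂ G hKn hl.1.ne' hT) := by
  -- the common open set and the compact chart image of the knot
  set W : Set (𝔼 3) := region θ₀ η ε ∩ (h.W₁ w ∩ h.W₂ w) with hW
  have hWo : IsOpen W := (isOpen_region θ₀ η ε).inter ((h.isOpen_W₁ w).inter (h.isOpen_W₂ w))
  have hxW : x₀ ∈ W := ⟨hx₀, hx₁, hx₂⟩
  set Z : Set (𝔼 3) := range fun y : 𝕊 1 ↦ psi (Kn y) with hZ
  have hZc : IsCompact Z := isCompact_range (Knot.contMDiff_psi_comp hKn).continuous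
  -- the two linearised embeddings
  have hg₁ : ContDiffOn ℝ ∞ (h.g₁ w) W := (h.contDiffOn_g₁ w).mono fun x hx ↦ hx.2.1
  have hg₂ : ContDiffOn ℝ ∞ (h.g₂ w) W := (h.contDiffOn_g₂ w).mono fun x hx ↦ hx.2.2
  set L₁ := equivOfInjective _ (h.injective_fderiv_g₁ G hx₀ hx₁) with hL₁
  set L₂ := equivOfInjective _ (h.injective_fderiv_g₂ G hx₀ hx₂) with hL₂
  have hL₁' : HasFDerivAt (h.g₁ w) (L₁ : (𝔼 3) →L[ℝ] 𝔼 3) x₀ := by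
    rw [hL₁, coe_equivOfInjective]; exact (h.differentiableAt_g₁ hx₁).hasFDerivAt
  have hL₂' : HasFDerivAt (h.g₂ w) (L₂ : (𝔼 3) →L[ℝ] 𝔼 3) x₀ := by
    rw [hL₂, coe_equivOfInjective]; exact (h.differentiableAt_g₂ hx₂).hasFDerivAt
  have hM₁ : 0 < (toMat ((L₁ : (𝔼 3) →L[ℝ] 𝔼 3).comp (M : (𝔼 3) →L[ℝ] 𝔼 3))).det := by
    rw [hL₁, coe_equivOfInjective]; exact hM
  have hM₂ : 0 < (toMat ((L₂ : (𝔼 3) →L[ℝ] 𝔼 3).comp (M : (𝔼 3) →L[ℝ] 𝔼 3))).det := by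
    rw [hL₂, coe_equivOfInjective]; exact h.det_toMat_comp_pos G hx₀ hx₁ hx₂ _ hM
  obtain ⟨l₁, hl₁, H₁⟩ := exists_ambientIsotopy_comp_affine hWo hg₁ hxW L₁ M hL₁' hM₁ hZc c
  obtain ⟨l₂, hl₂, H₂⟩ := exists_ambientIsotopy_comp_affine hWo hg₂ hxW L₂ M hL₂' hM₂ hZc c
  refine ⟨min l₁ l₂, lt_min hl₁ hl₂, fun l hl ↦ ?_⟩
  obtain ⟨hTW, F₁, hF₁, R₁, hR₁⟩ := H₁ l ⟨hl.1, lt_of_lt_of_le hl.2 (min_le_left _ _)⟩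
  obtain ⟨-, F₂, hF₂, R₂, hR₂⟩ := H₂ l ⟨hl.1, lt_of_lt_of_le hl.2 (min_le_right _ _)⟩
  have hmemW : ∀ y, affT x₀ c M l (psi (Kn y)) ∈ W := fun y ↦ hTW _ ⟨y, rfl⟩
  have hT : ∀ y, affT x₀ c M l (psi (Kn y)) ∈ region θ₀ η ε := fun y ↦ (hmemW y).1
  refine ⟨hT, fun y ↦ (hmemW y).2, ?_, ?_⟩
  · -- transport `F₁` along `ψ`
    set Φ₁ := F₁.alongChart (φ := psi) contMDiffOn_psi contMDiff_psi_symm psi_target hR₁ with hΦ₁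
    refine ⟨Φ₁, funext fun y ↦ Subtype.ext ?_⟩
    change ((Φ₁.toFun 1 (Kn y) : 𝕊 3) : 𝔼 4) = ((h.tinyKnot₁ G hKn hl.1.ne' hT y : 𝕊 3) : 𝔼 4)
    rw [h.coe_tinyKnot₁, hΦ₁, AmbientIsotopy.alongChart_toFun,
      chartTransport_of_mem _ (mem_psi_source (hKn y)), hF₁ _ ⟨y, rfl⟩]
    exact h.phi_g₁ (hmemW y).2.1
  · set Φ₂ := F₂.alongChart (φ := psi) contMDiffOn_psi contMDiff_psi_symm psi_target hR₂ with hΦ₂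
    refine ⟨Φ₂, funext fun y ↦ Subtype.ext ?_⟩
    change ((Φ₂.toFun 1 (Kn y) : 𝕊 3) : 𝔼 4) = ((h.tinyKnot₂ G hKn hl.1.ne' hT y : 𝕊 3) : 𝔼 4)
    rw [h.coe_tinyKnot₂, hΦ₂, AmbientIsotopy.alongChart_toFun,
      chartTransport_of_mem _ (mem_psi_source (hKn y)), hF₂ _ ⟨y, rfl⟩]
    exact h.phi_g₂ (hmemW y).2.2

end Tiny

end Knot.IsConicalConcordance

end Literature.Topology.FourManifolds
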